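import Mathlib
import Literature.Computability.Complexity.ExtMonotoneGates
import Literature.Computability.Complexity.CliqueApproximatorsWide
import Literature.Computability.Complexity.RossmanMonotoneCliqueProb
import Summits.PneNP.PneNP.Theorems.ConvexRankGatesLinAlgGateBlindDefs

/-!
# Reachable layer of stub `stub_sgPerm` of line `dnf-invariant-wide-gates-see-small-cliques` for crux `LinAlgGateBlind` (stmt-PneNP-10681, route ConvexRankGates)

The single-gate statement `SGAt m P l k q ε` of the line (module
`Summits.PneNP.PneNP.Theorems.ConvexRankGatesLinAlgGateBlindDefs`) asks, for every TERM GATE `O` of class `P`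
over `≤ l`-atoms (`IsTermGate`), for a small-clique DNF `⌈𝒜⌉`, `𝒜 ⊆ 𝒱(l)`, with one-sided errors
`#lostPos ≤ ε·C(m,k)` (bare `k`-cliques accepted by `O` but not by `⌈𝒜⌉`) and `gainedNeg ≤ ε`
(`Pr_{G(m,q)}[O = 0 ∧ ⌈𝒜⌉ = 1]`). This file proves the REACHABLE LAYER of the research stub `stub_sgPerm`
(and of its twin `stub_sgGRank`), valid for an ARBITRARY class `P` of monotone gates:

* `sgAt_trivial_of_prob_reject_le` — the ε-TRIVIAL regime: if `O` rejects at most `ε` of `G(m,q)` then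
  `𝒜 = {∅}` (the always-true atom, `Razborov.empty_mem_smallSets`, `cliquePresent_empty`) works;
* `sg_of_locality` — the ε-LOCAL regime: if all but `ε·C(m,k)` of the bare `k`-cliques `K_S` accepted by a
  MONOTONE `O` contain some `X ∈ 𝒱(l)`, `X ⊆ S`, whose bare clique `K_X` is already accepted, then
  `𝒜* = {X ∈ 𝒱(l) : O(K_X) = 1}` works with ZERO negative error (a graph containing `K_X` is accepted by
  monotonicity); the case "few accepted cliques" (`𝒜 = ∅`) is the sub-case where the hypothesis holds trivially;
* `sgAt_of_plantedFamily` — the general PLANTED-FAMILY form (no monotonicity needed, `q ∈ [0,1]`): a family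
  `𝒜 ⊆ 𝒱(l)` such that at most `ε·C(m,k)` accepted bare `k`-cliques contain no member of `𝒜` and the planted
  rejection masses `Pr[O = 0 ∧ ⌈Y⌉]`, `Y ∈ 𝒜`, sum to `≤ ε`, witnesses the clause (union bound `prob_exists_le`);
* `sgAt_of_partition` — the packaging: if every term gate of class `P` (all gates of `P` monotone) is ε-trivial
  or ε-local on the referee pair, then `SGAt m P l k q ε`;
* `not_mem_closure_iff_exists_subgroup`, `isTermGate_perm_eq_false_iff` — the MAXTERM COVER of a PERM term gate:
  `O(x) = 0` iff for some subgroup `K ∌ τ` every wired atom whose generator lies outside `K` is absent from `x`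
  (the structural input of the adaptive planting argument recorded in the stub report, which proves the clause for
  every gate whose rejection region is a union of few such "all-off" events).

Consequently the residual content of `stub_sgPerm` is exactly: every `PERM_{m^c}` term gate over `≤ lOf m`-atoms
is `epsOf c m`-trivial or `epsOf c m`-local on (bare `kOf m`-cliques, `G(m, qOf m)`), eventually, OR has a
genuinely mixed approximating DNF. The lemmas `atomB_mono`, `isTermGate_monotone`, `cliqueVec_le_of_cliquePresent`,
`sg_of_locality` are adapted from §3 of the skeleton
`Summits/PneNP/PneNP/Cruxes/LinAlgGateBlind/Lines/dnf-invariant-wide-gates-see-small-cliques.lean`; the trivial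
regime is the skeleton-copy lemma `hasApprox_of_prob_reject_le` of `Cruxes/LinAlgGateBlind/Disproof.lean` §(d').
Sources: Alon–Boppana 1987 §3 (clique indicators, Lemma 3.8), Razborov 1985. [folklore]
-/

-- `Summit.PneNP.PneNP.…` duplicates `PneNP` BY DESIGN (single-problem summit).
set_option linter.dupNamespace false

noncomputable section

namespace Summit.PneNP.PneNP.Cruxes.LinAlgGateBlind.DnfInvariantWideGatesSeeSmallCliques

open scoped BigOperators
open Finset Filter Literature.Computability.Complexity Razborov

/-! ### Monotonicity of atoms and term gates -/

open Classical in
/-- Atoms are monotone in the graph (adapted from the skeleton §3). [folklore] -/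
theorem atomB_mono {m : ℕ} (X : Finset (Fin m)) : Monotone (atomB X) := by
  intro x y hxy
  unfold atomB
  by_cases h : CliquePresent X x
  · have hy : CliquePresent X y := fun e he => eq_true_of_le_of_eq_true (hxy e) (h e he)
    rw [decide_eq_true h, decide_eq_true hy]
  · rw [decide_eq_false h]
    exact Bool.false_le _

/-- A term gate over a class of monotone gates is a monotone function of the graph (adapted from the
skeleton §3). [folklore] -/
theorem isTermGate_monotone {m l : ℕ} {P : GateFn → Prop} (hP : ∀ g, P g → Monotone g.2)
    {O : (KEdge m → Bool) → Bool} (h : IsTermGate m P l O) : Monotone O := by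
  obtain ⟨g, hg, X, -, hO⟩ := h
  intro x y hxy
  rw [hO x, hO y]
  exact hP g hg (fun a => atomB_mono (X a) hxy)

/-- In a graph containing the clique on `X`, the clique vector of `X` is below the graph (adapted from the
skeleton §3). [folklore] -/
theorem cliqueVec_le_of_cliquePresent {m : ℕ} {X : Finset (Fin m)} {x : KEdge m → Bool}
    (h : CliquePresent X x) : cliqueVec X ≤ x := by
  intro e
  rcases hX : cliqueVec X e with _ | _
  · exact Bool.false_le _
  · exact (h e ((cliqueVec_eq_true_iff X e).1 hX)).symm.le

/-! ### The two reachable regimes: ε-trivial and ε-local term gates -/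

open Classical in
/-- **The ε-trivial regime.** If `O` rejects at most `ε` of `G(m,q)`, then `𝒜 = {∅}` (accept everything:
`⌈∅⌉ ≡ true`) witnesses the approximator clause of `SGAt` with ZERO positive error (adapted from
`hasApprox_of_prob_reject_le`, Disproof §(d')). [folklore] -/
theorem sgAt_trivial_of_prob_reject_le {m l k : ℕ} (q ε : ℝ) (hε : 0 ≤ ε) (O : (KEdge m → Bool) → Bool)
    (h : prob q (fun x : KEdge m → Bool => O x = false) ≤ ε) :
    ∃ 𝒜 ⊆ smallSets (Fin m) l,
      (#(lostPos m k O 𝒜) : ℝ) ≤ ε * (m.choose k : ℝ) ∧ gainedNeg m q O 𝒜 ≤ ε := by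
  refine ⟨{∅}, singleton_subset_iff.2 (empty_mem_smallSets l), ?_, ?_⟩
  · have h0 : lostPos m k O {∅} = ∅ := by
      refine filter_false_of_mem fun S _ => ?_
      simp only [not_and, not_not]
      exact fun _ => accepts_of_empty_mem (mem_singleton_self _) _
    rw [h0, card_empty, Nat.cast_zero]
    positivity
  · unfold gainedNeg
    rw [prob_congr (Q := fun x => O x = false)
      (fun x => ⟨fun hx => hx.1, fun hx => ⟨hx, accepts_of_empty_mem (mem_singleton_self _) _⟩⟩)]
    exact h

open Classical in
/-- **The ε-local regime (locality ⇒ SG with zero negative error).** For ANY monotone `O`: if all but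
`ε·C(m,k)` of the bare `k`-cliques accepted by `O` contain a small vertex set `X ∈ 𝒱(l)` whose bare clique `O`
already accepts, then `𝒜* = {X ∈ 𝒱(l) : O(K_X) = 1}` witnesses `SG(O)` with ZERO negative error (a graph
containing `K_X` with `O(K_X) = 1` is accepted by `O`, by monotonicity). Adapted from the skeleton §3.
[folklore] -/
theorem sg_of_locality {m l k : ℕ} (q ε : ℝ) (O : (KEdge m → Bool) → Bool) (hO : Monotone O)
    (hloc : (#((powersetCard k (univ : Finset (Fin m))).filter fun S =>
        O (cliqueVec S) = true ∧ ∀ X ∈ smallSets (Fin m) l, X ⊆ S → O (cliqueVec X) = false) : ℝ)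
        ≤ ε * (m.choose k : ℝ)) :
    ∃ 𝒜 ⊆ smallSets (Fin m) l,
      (#(lostPos m k O 𝒜) : ℝ) ≤ ε * (m.choose k : ℝ) ∧ gainedNeg m q O 𝒜 = 0 := by
  refine ⟨(smallSets (Fin m) l).filter fun X => O (cliqueVec X) = true, filter_subset _ _, ?_, ?_⟩
  · have hsub : lostPos m k O ((smallSets (Fin m) l).filter fun X => O (cliqueVec X) = true) ⊆
        (powersetCard k (univ : Finset (Fin m))).filter fun S =>
          O (cliqueVec S) = true ∧ ∀ X ∈ smallSets (Fin m) l, X ⊆ S → O (cliqueVec X) = false := by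
      intro S hS
      simp only [lostPos, mem_filter] at hS
      obtain ⟨hSk, hOS, hnacc⟩ := hS
      refine mem_filter.2 ⟨hSk, hOS, fun X hX hXS => ?_⟩
      rcases hOX : O (cliqueVec X) with _ | _
      · rfl
      · exact absurd ⟨X, mem_filter.2 ⟨hX, hOX⟩, (cliquePresent_cliqueVec_self S).anti hXS⟩ hnacc
    exact le_trans (by exact_mod_cast card_le_card hsub) hloc
  · have hempty : prob q (fun x : KEdge m → Bool =>
        O x = false ∧ Accepts ((smallSets (Fin m) l).filter fun X => O (cliqueVec X) = true) x) =
        prob q (fun _ : KEdge m → Bool => False) := by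
      refine prob_congr fun x => ⟨?_, fun h => h.elim⟩
      rintro ⟨hOx, X, hX, hXx⟩
      have h1 : O (cliqueVec X) = true := (mem_filter.1 hX).2
      have h2 := hO (cliqueVec_le_of_cliquePresent hXx)
      rw [h1, hOx] at h2
      exact absurd h2 (by decide)
    unfold gainedNeg
    rw [hempty, prob_false]

/-! ### Planted families: the approximator clause up to a union bound on the negative side -/

open Classical in
/-- **SG from a planted family (union bound).** For an arbitrary class `P` (no monotonicity needed) and
`q ∈ [0,1]`: if every term gate `O` of class `P` admits a family `𝒜 ⊆ 𝒱(l)` such that (i) at most `ε·C(m,k)`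
bare `k`-cliques `K_S` accepted by `O` contain no member of `𝒜`, and (ii) the planted rejection masses
`Pr_{G(m,q)}[O = 0 ∧ K_Y ⊆ G]`, `Y ∈ 𝒜`, SUM to at most `ε`, then `SGAt m P l k q ε` (witness `𝒜` itself:
`⌈𝒜⌉(K_S) = 1` iff some `Y ∈ 𝒜` has `Y ⊆ S`, and `gainedNeg ≤ Σ_Y Pr[O = 0 ∧ ⌈Y⌉]` by the union bound
`prob_exists_le`). The trivial regime is `𝒜 = {∅}`, the local regime is `𝒜 = {X : O(K_X) = 1}` (all summands
zero); in general `𝒜` may be any family of "dead ends of planting" `Y` with `Pr[O = 0 ∧ ⌈Y⌉] ≤ ε / #𝒜`.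
[folklore] -/
theorem sgAt_of_plantedFamily :
    ∀ (m l k : ℕ) (q ε : ℝ) (P : GateFn → Prop), 0 ≤ q → q ≤ 1 →
      (∀ O, IsTermGate m P l O → ∃ 𝒜 ⊆ smallSets (Fin m) l,
        (#((powersetCard k (univ : Finset (Fin m))).filter fun S =>
            O (cliqueVec S) = true ∧ ∀ Y ∈ 𝒜, ¬ Y ⊆ S) : ℝ) ≤ ε * (m.choose k : ℝ) ∧
        ∑ Y ∈ 𝒜, prob q (fun x : KEdge m → Bool => O x = false ∧ CliquePresent Y x) ≤ ε) →
      SGAt m P l k q ε := by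
  intro m l k q ε P hq0 hq1 h O hO
  obtain ⟨𝒜, h𝒜, hPos, hNeg⟩ := h O hO
  refine ⟨𝒜, h𝒜, ?_, ?_⟩
  · have hsub : lostPos m k O 𝒜 ⊆ (powersetCard k (univ : Finset (Fin m))).filter fun S =>
        O (cliqueVec S) = true ∧ ∀ Y ∈ 𝒜, ¬ Y ⊆ S := by
      intro S hS
      simp only [lostPos, mem_filter] at hS
      obtain ⟨hSk, hOS, hnacc⟩ := hS
      exact mem_filter.2 ⟨hSk, hOS, fun Y hY hYS =>
        hnacc ⟨Y, hY, (cliquePresent_cliqueVec_self S).anti hYS⟩⟩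
    exact le_trans (by exact_mod_cast card_le_card hsub) hPos
  · unfold gainedNeg
    calc prob q (fun x : KEdge m → Bool => O x = false ∧ Accepts 𝒜 x)
        = prob q (fun x : KEdge m → Bool => ∃ Y ∈ 𝒜, O x = false ∧ CliquePresent Y x) :=
          prob_congr fun x =>
            ⟨fun ⟨hOx, Y, hY, hYx⟩ => ⟨Y, hY, hOx, hYx⟩, fun ⟨Y, hY, hOx, hYx⟩ => ⟨hOx, Y, hY, hYx⟩⟩
      _ ≤ ∑ Y ∈ 𝒜, prob q (fun x : KEdge m → Bool => O x = false ∧ CliquePresent Y x) :=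
          prob_exists_le hq0 hq1 𝒜 _
      _ ≤ ε := hNeg

/-! ### The maxterm cover of a PERM term gate (entry point of the planting argument) -/

/-- **Subgroup cover of rejection.** For permutation data `σ, τ`: the target `τ` is NOT generated by the available
generators `{σ i : v i = 1}` iff some subgroup `K ∌ τ` contains every available generator, i.e. iff for some `K ∌ τ`
all inputs `i` with `σ i ∉ K` are off. (So the rejection region of a PERM gate is the union, over the `≤ #Sub(S_d)`
subgroups `K ∌ τ`, of the events "all inputs outside `K` are off".) [folklore] -/
theorem not_mem_closure_iff_exists_subgroup {n d : ℕ} (σ : Fin n → Equiv.Perm (Fin d)) (τ : Equiv.Perm (Fin d))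
    (v : Fin n → Bool) :
    τ ∉ Subgroup.closure (σ '' {i | v i = true}) ↔
      ∃ K : Subgroup (Equiv.Perm (Fin d)), τ ∉ K ∧ ∀ i, σ i ∉ K → v i = false := by
  constructor
  · intro hτ
    refine ⟨Subgroup.closure (σ '' {i | v i = true}), hτ, fun i hi => ?_⟩
    rcases hv : v i with _ | _
    · rfl
    · exact absurd (Subgroup.subset_closure (Set.mem_image_of_mem σ hv)) hi
  · rintro ⟨K, hτK, hK⟩ hτ
    refine hτK ((Subgroup.closure_le K).2 ?_ hτ)
    rintro _ ⟨i, hi, rfl⟩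
    by_contra hσ
    have := hK i hσ
    rw [Set.mem_setOf_eq] at hi
    rw [hi] at this
    exact absurd this (by decide)

/-- **Maxterm cover of a PERM term gate.** A term gate `O` of class `PERM_s` over `≤ l`-atoms rejects a graph `x` iff,
for some subgroup `K ∌ τ` of its permutation data, every wired atom `X_a` whose generator `σ_a` lies outside `K` is
absent from `x` (not a clique of `x`). This exhibits `{O = 0}` as a union of at most `#Sub(Sym(Fin d))` events of the
form "all atoms of a sub-family are off" — the shape consumed by the adaptive planting argument (report of stub
`stub_sgPerm`, §1). [folklore] -/
theorem isTermGate_perm_eq_false_iff {m s l : ℕ} {O : (KEdge m → Bool) → Bool}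
    (hO : IsTermGate m (IsPermGate s) l O) :
    ∃ (n d : ℕ) (_ : d ≤ s) (σ : Fin n → Equiv.Perm (Fin d)) (τ : Equiv.Perm (Fin d))
      (X : Fin n → Finset (Fin m)), (∀ a, X a ∈ smallSets (Fin m) l) ∧
      ∀ x, O x = false ↔
        ∃ K : Subgroup (Equiv.Perm (Fin d)), τ ∉ K ∧ ∀ a, σ a ∉ K → ¬ CliquePresent (X a) x := by
  classical
  obtain ⟨g, ⟨d, hd, σ, τ, hg⟩, X, hX, hOX⟩ := hO
  refine ⟨g.1, d, hd, σ, τ, X, hX, fun x => ?_⟩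
  have h1 : O x = false ↔ τ ∉ Subgroup.closure (σ '' {i | (fun a => atomB (X a) x) i = true}) := by
    rw [← hg, hOX x]
    exact ⟨fun h h' => by rw [h] at h'; exact absurd h' (by decide), fun h => by
      rcases hv : g.2 (fun a => atomB (X a) x) with _ | _
      · rfl
      · exact absurd hv h⟩
  rw [h1, not_mem_closure_iff_exists_subgroup]
  refine exists_congr fun K => and_congr_right fun _ => forall_congr' fun a => imp_congr_right fun _ => ?_
  unfold atomB
  exact ⟨fun h hP => by rw [decide_eq_true hP] at h; exact absurd h (by decide),
    fun h => decide_eq_false h⟩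

/-! ### The packaging: ε-trivial or ε-local term gates ⇒ SG -/

/-- **Reachable layer of `stub_sgPerm` / `stub_sgGRank`.** For an arbitrary class `P` of monotone gates: if
every term gate `O` of class `P` over `≤ l`-atoms is ε-TRIVIAL (rejects `≤ ε` of `G(m,q)`; witness `{∅}`) or
ε-LOCAL (all but `ε·C(m,k)` of the bare `k`-cliques it accepts contain an accepted small sub-clique; witness
`𝒜* = {X ∈ 𝒱(l) : O(K_X) = 1}`, which subsumes the case of `≤ ε·C(m,k)` accepted cliques), then the
single-gate statement `SGAt m P l k q ε` holds. The residual content of the research stubs is thus the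
trivial-or-local dichotomy for `PERM_{m^c}` / `GRANK_{m^c}` term gates on the referee pair (or a genuinely mixed
approximating DNF). [folklore] -/
theorem sgAt_of_partition :
    ∀ (m l k : ℕ) (q ε : ℝ) (P : GateFn → Prop), 0 ≤ ε → (∀ g, P g → Monotone g.2) →
      (∀ O, IsTermGate m P l O →
        prob q (fun x : KEdge m → Bool => O x = false) ≤ ε ∨
        (#((powersetCard k (univ : Finset (Fin m))).filter fun S =>
            O (cliqueVec S) = true ∧ ∀ X ∈ smallSets (Fin m) l, X ⊆ S → O (cliqueVec X) = false) : ℝ)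
          ≤ ε * (m.choose k : ℝ)) →
      SGAt m P l k q ε := by
  intro m l k q ε P hε hP h O hO
  rcases h O hO with htriv | hloc
  · exact sgAt_trivial_of_prob_reject_le q ε hε O htriv
  · obtain ⟨𝒜, h𝒜, hPos, hNeg⟩ := sg_of_locality q ε O (isTermGate_monotone hP hO) hloc
    exact ⟨𝒜, h𝒜, hPos, hNeg.le.trans hε⟩

end Summit.PneNP.PneNP.Cruxes.LinAlgGateBlind.DnfInvariantWideGatesSeeSmallCliques

end
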